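import Mathlib
import HarnessLib.Audit

/-!
# Rung C1 of the crux `EulerZoomLiouville.PowerGaugeEulerLiouville`, NO-DRIFT lane (3a/3): topological tools —
# the limit set of a curve with compact tail is preconnected; tails enter neighbourhoods of the limit set; first exits

Route №10 `EulerZoomLiouville` (NavierStokesRegularity), crux E = stmt-NavierStokesRegularity-19832, tenure rung C1.
Lineage ns-typeII-p2 (gen 7).  GENERIC TOPOLOGY of a continuous curve `γ : ℝ → X` (metric space) whose tail at `−∞`
stays in a compact set `K`:

* `mem_of_mapClusterPt_of_eventually` — limit points lie in any closed set eventually containing the curve;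
* `eventually_mem_of_mapClusterPt_subset` — if every limit point lies in the open set `O`, the curve is eventually in
  `O` (Robinson, *Dynamical Systems*, Ch. V Thm 4.1 (d): `d(φᵗ(x), α(x)) → 0`);
* `isPreconnected_setOf_mapClusterPt` — **the limit set `{z | MapClusterPt z atBot γ}` is preconnected** (ibid.:
  limit sets of bounded semi-orbits are connected; proof: two disjoint closed pieces are separated by disjoint open
  sets, the connected tail `γ((−∞, S])` lies in one of them, and the other piece has no limit point);
* `exists_first_exit` — a continuous curve inside an open set `U` at time `t` and outside at a later time has a first
  exit time `u > t`: `γ([t, u)) ⊆ U`, `γ(u) ∈ closure U ∖ U`.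

WHAT THIS IS NOT: not NS — topology. [folklore; cf. Robinson1999 Ch. V Thm 4.1 (d)]
-/

noncomputable section

open Set Filter Metric Function
open scoped Topology

-- flat `Theorems/<Route><Decl>…` files of one crux share the namespace of the crux (tree convention)
set_option linter.dupNamespace false

namespace Summit.NavierStokesRegularity.NavierStokesRegularity.Theorems.PowerGaugeEulerLiouville.NoDrift

variable {X : Type*} [MetricSpace X]

/-- A limit point of a curve lies in every closed set that eventually contains the curve. [folklore] -/
theorem mem_of_mapClusterPt_of_eventually {γ : ℝ → X} {l : Filter ℝ} {C : Set X} (hC : IsClosed C)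
    (hev : ∀ᶠ s in l, γ s ∈ C) {z : X} (hz : MapClusterPt z l γ) : z ∈ C := by
  by_contra hzC
  have h := hz.frequently (hC.isOpen_compl.mem_nhds hzC)
  have h2 : ∃ᶠ s in l, False := (h.and_eventually hev).mono fun s hs => hs.1 hs.2
  exact frequently_false l h2

/-- **The tail enters every open neighbourhood of the limit set** (compact tail): if every limit point of `γ` along
`l` lies in the open set `O` and the curve is eventually in the compact set `K`, then it is eventually in `O`.
[folklore; cf. Robinson1999 Ch. V Thm 4.1 (d)] -/
theorem eventually_mem_of_mapClusterPt_subset {γ : ℝ → X} {l : Filter ℝ} [NeBot l] {K O : Set X}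
    (hK : IsCompact K) (hev : ∀ᶠ s in l, γ s ∈ K) (hO : IsOpen O)
    (hZ : ∀ z, MapClusterPt z l γ → z ∈ O) : ∀ᶠ s in l, γ s ∈ O := by
  by_contra hnot
  have hfreq : ∃ᶠ s in l, γ s ∈ K \ O :=
    ((not_eventually.1 hnot).and_eventually hev).mono fun s hs => ⟨hs.2, hs.1⟩
  obtain ⟨z, hz, hcl⟩ := (hK.diff hO).exists_mapClusterPt_of_frequently hfreq
  exact hz.2 (hZ z hcl)

/-- **THE LIMIT SET OF A CURVE WITH COMPACT TAIL IS PRECONNECTED** (`t → −∞` version). [folklore; cf. Robinson1999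
Ch. V Thm 4.1 (d) («α(x) is nonempty, compact, and connected»)] -/
theorem isPreconnected_setOf_mapClusterPt {γ : ℝ → X} (hγ : Continuous γ) {K : Set X} (hK : IsCompact K)
    (hev : ∀ᶠ s in atBot, γ s ∈ K) : IsPreconnected {z | MapClusterPt z atBot γ} := by
  set Z : Set X := {z | MapClusterPt z atBot γ} with hZdef
  have hZK : Z ⊆ K := fun z hz => mem_of_mapClusterPt_of_eventually hK.isClosed hev hz
  have hZcl : IsClosed Z := isClosed_setOf_clusterPt
  rw [isPreconnected_closed_iff]
  intro t t' ht ht' hcover ⟨z₁, hz₁⟩ ⟨z₂, hz₂⟩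
  by_contra hempty
  rw [not_nonempty_iff_eq_empty] at hempty
  -- the two closed pieces
  set Z₁ : Set X := Z ∩ t with hZ₁
  set Z₂ : Set X := Z ∩ t' with hZ₂
  have hZ₁c : IsCompact Z₁ := hK.of_isClosed_subset (hZcl.inter ht) (inter_subset_left.trans hZK)
  have hZ₂c : IsCompact Z₂ := hK.of_isClosed_subset (hZcl.inter ht') (inter_subset_left.trans hZK)
  have hdisj : Disjoint Z₁ Z₂ := by
    rw [Set.disjoint_iff]
    rintro z ⟨⟨hz, hzt⟩, ⟨-, hzt'⟩⟩
    have : z ∈ Z ∩ (t ∩ t') := ⟨hz, hzt, hzt'⟩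
    rw [hempty] at this
    exact this
  obtain ⟨U, V, hU, hV, hZ₁U, hZ₂V, hUV⟩ := SeparatedNhds.of_isCompact_isCompact hZ₁c hZ₂c hdisj
  -- the tail is eventually in `U ∪ V`
  have htail : ∀ᶠ s in atBot, γ s ∈ U ∪ V := by
    refine eventually_mem_of_mapClusterPt_subset hK hev (hU.union hV) fun z hz => ?_
    rcases hcover hz with h | h
    · exact Or.inl (hZ₁U ⟨hz, h⟩)
    · exact Or.inr (hZ₂V ⟨hz, h⟩)
  obtain ⟨S, hS⟩ := eventually_atBot.1 htail
  -- the connected tail piece `γ((−∞, S])` lies in `U` or in `V`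
  have hpre : IsPreconnected (γ '' Iic S) := isPreconnected_Iic.image γ hγ.continuousOn
  have hsub : γ '' Iic S ⊆ U ∪ V := by
    rintro _ ⟨s, hs, rfl⟩; exact hS s hs
  rcases hpre.subset_or_subset hU hV hUV hsub with h | h
  · -- then `z₂ ∈ V` is not a limit point
    have hfr := hz₂.1.frequently (hV.mem_nhds (hZ₂V hz₂))
    have hev' : ∀ᶠ s in atBot, γ s ∈ U := by
      filter_upwards [eventually_le_atBot S] with s hs
      exact h ⟨s, hs, rfl⟩
    have h2 : ∃ᶠ s in atBot, False :=
      (hfr.and_eventually hev').mono fun s hs => (Set.disjoint_left.1 hUV) hs.2 hs.1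
    exact frequently_false _ h2
  · have hfr := hz₁.1.frequently (hU.mem_nhds (hZ₁U hz₁))
    have hev' : ∀ᶠ s in atBot, γ s ∈ V := by
      filter_upwards [eventually_le_atBot S] with s hs
      exact h ⟨s, hs, rfl⟩
    have h2 : ∃ᶠ s in atBot, False :=
      (hfr.and_eventually hev').mono fun s hs => (Set.disjoint_left.1 hUV) hs.1 hs.2
    exact frequently_false _ h2

/-- **First exit time.**  If a continuous curve is in the open set `U` at time `t` and outside `U` at some time
`t' > t`, there is a first exit time `u ∈ (t, t']`: `γ(s) ∈ U` for `s ∈ [t, u)` and `γ(u) ∈ closure U ∖ U`.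
[folklore] -/
theorem exists_first_exit {γ : ℝ → X} (hγ : Continuous γ) {U : Set X} (hU : IsOpen U) {t t' : ℝ} (htt' : t < t')
    (ht : γ t ∈ U) (ht' : γ t' ∉ U) :
    ∃ u, t < u ∧ u ≤ t' ∧ (∀ s ∈ Ico t u, γ s ∈ U) ∧ γ u ∉ U ∧ γ u ∈ closure U := by
  set A : Set ℝ := {s | t ≤ s ∧ γ s ∉ U} with hA
  have hAne : A.Nonempty := ⟨t', htt'.le, ht'⟩
  have hAbdd : BddBelow A := ⟨t, fun s hs => hs.1⟩
  have hAcl : IsClosed A := by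
    have : A = Ici t ∩ γ ⁻¹' Uᶜ := by ext s; simp [hA, mem_Ici]
    rw [this]
    exact isClosed_Ici.inter (hU.isClosed_compl.preimage hγ)
  set u := sInf A with hu
  have huA : u ∈ A := hAcl.csInf_mem hAne hAbdd
  have htu : t ≤ u := huA.1
  have hne : u ≠ t := by
    intro h; rw [h] at huA; exact huA.2 ht
  have htu' : t < u := lt_of_le_of_ne htu (Ne.symm hne)
  have hbefore : ∀ s ∈ Ico t u, γ s ∈ U := by
    intro s hs
    by_contra h
    have : u ≤ s := csInf_le hAbdd ⟨hs.1, h⟩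
    exact absurd hs.2 (not_lt.2 this)
  refine ⟨u, htu', csInf_le hAbdd ⟨htt'.le, ht'⟩, hbefore, huA.2, ?_⟩
  -- `γ u` is a limit of points of `U`
  have hlim : Tendsto γ (𝓝[<] u) (𝓝 (γ u)) := (hγ.tendsto u).mono_left nhdsWithin_le_nhds
  refine mem_closure_of_tendsto hlim ?_
  have : Ico t u ∈ 𝓝[<] u := Ico_mem_nhdsLT htu'
  filter_upwards [this] with s hs
  exact hbefore s hs

end Summit.NavierStokesRegularity.NavierStokesRegularity.Theorems.PowerGaugeEulerLiouville.NoDrift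

end
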